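import Literature.NumberTheory.EllipticCurves.GaloisAction
import Literature.AlgebraicGeometry.PlaneCurves.WeierstrassChordTangent
import HarnessLib

/-!
# Mod-`3` congruences of elliptic curves by a projective-linear transport of flexes, I:
# the transport is an odd, injective, ADDITIVE map `W'[3] → W[3]`
# (syzygetic pencil: Fisher, *The Hessian of a genus one curve*, Thm. 8.2 / 13.2;
# Artebani–Dolgachev, *The Hesse pencil of plane cubic curves*, §§2–3)

Topic `Literature/NumberTheory/EllipticCurves`, namespace `Literature.NumberTheory.EllipticCurves.FlexTransport`.
Part I of two files (Part II: `ModThreeCongruenceFlexTransportGalois` — bijectivity, Galois equivariance, the main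
theorem and the certificate form; the full discussion and references are there). Everything is PROVED; one data
`structure` (`Datum`), one `Prop`-valued hypothesis structure (`IsFlexTransport`), plain `def`s. Setting: `E, E'`
Weierstrass cubics over a field `K`, and a matrix `M = !![m₁₁, 0, m₁₃; m₂₁, m₂₂, m₂₃; m₃₁, 0, m₃₃]` over `K` fixing
`O = (0 : 1 : 0)`, acting on the affine chart by `(x, y) ↦ (u, v) = ((m₁₁x + m₁₃)/(m₃₁x + m₃₃), (m₂₁x + m₂₂y +
m₂₃)/(m₃₁x + m₃₃))` (`Datum.u`, `Datum.v`; `transport` on points). Hypothesis `IsFlexTransport E E' c`: `m₂₂ ≠ 0`,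
`m₁₁m₃₃ − m₁₃m₃₁ ≠ 0`, and every affine point `(x, y)` of `E'` with `Ψ₃^{E'}(x) = 0` (= the affine points of order
`3` = the eight affine flexes; tree `addOrderOf_eq_three_iff_Ψ₃_eval_eq_zero`, [cite: SilvermanTate2015, §2.1, Thm.
2.1 (c)]) has `m₃₁x + m₃₃ ≠ 0`, `(u, v) ∈ E` and `Ψ₃^{E}(u) = 0`.

What is proved here: on `E'[3]` the transport lands in `E[3]` (`three_zsmul_transport_eq_zero`), is odd
(`transport_neg`: `M` carries the vertical line through `P, −P, O` to a vertical line), injective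
(`transport_injective`), and **additive** (`transport_add`): for `P, Q ∈ E'[3]` with distinct abscissae the points
`P, Q, R = −(P + Q)` are the three intersections of their chord with `E'` (Mathlib's chord–tangent law [cite:
SilvermanAEC2009, III.2, Group Law Algorithm 2.3]), so `M(P), M(Q), M(R)` are collinear
(`Datum.collinear_transport`) affine flexes of `E`, and the secant theorem on `E` (tree
`eval_weierstrass_secant_eq_zero_iff`: a chord meets the cubic exactly in `U₁, U₂, −(U₁ + U₂)`) gives `M(R) = −(M(P)
+ M(Q))` — "three flexes are collinear iff they sum to `O`", the group law of the Hesse configuration [cite: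
ArtebaniDolgachev2009, §2–§3]; the cases `Q = ±P` follow from oddness and `2P = −P`.

References: [Fisher2012Hessian] T. Fisher, *The Hessian of a genus one curve*, Proc. LMS (3) 104 (2012) 613–648,
Thm. 8.2, Thm. 13.2 [held: paper:arxiv-math_0610403, pp. 12, 19]; [ArtebaniDolgachev2009] M. Artebani, I. Dolgachev,
*The Hesse pencil of plane cubic curves*, Enseign. Math. 55 (2009) 235–273, §§2–3; [SilvermanTate2015] §2.1, Thm.
2.1 (c); [SilvermanAEC2009] III.2.3.
-/

set_option autoImplicit false

noncomputable section

open scoped Classical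

universe u

namespace Literature.NumberTheory.EllipticCurves.FlexTransport

open WeierstrassCurve Literature.AlgebraicGeometry.PlaneCurves

/-! ## §1. The transport datum and its maps -/

/-- A projective-linear map `M = !![m₁₁, 0, m₁₃; m₂₁, m₂₂, m₂₃; m₃₁, 0, m₃₃]` of the plane fixing the
point `O = (0 : 1 : 0)` (second column `(0, m₂₂, 0)`), recorded by its seven free entries. On the
affine chart `z = 1` it acts by `(x, y) ↦ (u, v)` with `u = (m₁₁x + m₁₃)/(m₃₁x + m₃₃)` (a Möbius map
in `x` alone) and `v = (m₂₁x + m₂₂y + m₂₃)/(m₃₁x + m₃₃)`. [cite: Fisher2012Hessian, §13, Thm. 13.2 (n = 3)] -/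
structure Datum (K : Type u) where
  /-- entry `(1,1)` -/ m₁₁ : K
  /-- entry `(1,3)` -/ m₁₃ : K
  /-- entry `(2,1)` -/ m₂₁ : K
  /-- entry `(2,2)` -/ m₂₂ : K
  /-- entry `(2,3)` -/ m₂₃ : K
  /-- entry `(3,1)` -/ m₃₁ : K
  /-- entry `(3,3)` -/ m₃₃ : K

namespace Datum

variable {K : Type u} [Field K] (c : Datum K)

/-- The denominator `Z = m₃₁x + m₃₃` of the transport. [cite: Fisher2012Hessian, §13, Thm. 13.2 (n = 3)] -/
def den (x : K) : K := c.m₃₁ * x + c.m₃₃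

/-- The abscissa `u = (m₁₁x + m₁₃)/(m₃₁x + m₃₃)` of the transported point. [cite: Fisher2012Hessian, §13, Thm. 13.2 (n = 3)] -/
def u (x : K) : K := (c.m₁₁ * x + c.m₁₃) / c.den x

/-- The ordinate `v = (m₂₁x + m₂₂y + m₂₃)/(m₃₁x + m₃₃)` of the transported point. [cite: Fisher2012Hessian, §13, Thm. 13.2 (n = 3)] -/
def v (x y : K) : K := (c.m₂₁ * x + c.m₂₂ * y + c.m₂₃) / c.den x

/-- Base change of a datum along a ring map (the transport is defined over the ground field).
[cite: Fisher2012Hessian, §13, Thm. 13.2 (n = 3)] -/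
def map {L : Type u} [Field L] (f : K →+* L) : Datum L :=
  ⟨f c.m₁₁, f c.m₁₃, f c.m₂₁, f c.m₂₂, f c.m₂₃, f c.m₃₁, f c.m₃₃⟩

/-- The denominator commutes with base change. [cite: Fisher2012Hessian, §13, Thm. 13.2 (n = 3)] -/
theorem map_den {L : Type u} [Field L] (f : K →+* L) (x : K) : (c.map f).den (f x) = f (c.den x) := by
  simp [den, map]

/-- The abscissa `u` commutes with base change. [cite: Fisher2012Hessian, §13, Thm. 13.2 (n = 3)] -/
theorem map_u {L : Type u} [Field L] (f : K →+* L) (x : K) : (c.map f).u (f x) = f (c.u x) := by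
  simp [u, den, map, map_div₀]

/-- The ordinate `v` commutes with base change. [cite: Fisher2012Hessian, §13, Thm. 13.2 (n = 3)] -/
theorem map_v {L : Type u} [Field L] (f : K →+* L) (x y : K) :
    (c.map f).v (f x) (f y) = f (c.v x y) := by
  simp [v, den, map, map_div₀]

/-- The Möbius map `u` is injective where it is defined, provided `m₁₁m₃₃ − m₁₃m₃₁ ≠ 0`. [cite: Fisher2012Hessian, §13, Thm. 13.2 (n = 3)] -/
theorem u_injective (hdet : c.m₁₁ * c.m₃₃ - c.m₁₃ * c.m₃₁ ≠ 0) {x₁ x₂ : K}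
    (h₁ : c.den x₁ ≠ 0) (h₂ : c.den x₂ ≠ 0) (h : c.u x₁ = c.u x₂) : x₁ = x₂ := by
  simp only [u, den] at h h₁ h₂
  rw [div_eq_div_iff h₁ h₂] at h
  have : (c.m₁₁ * c.m₃₃ - c.m₁₃ * c.m₃₁) * (x₁ - x₂) = 0 := by linear_combination h
  exact sub_eq_zero.1 ((mul_eq_zero.1 this).resolve_left hdet)

/-- For fixed `x`, `y ↦ v(x, y)` is injective, provided `m₂₂ ≠ 0`. [cite: Fisher2012Hessian, §13, Thm. 13.2 (n = 3)] -/
theorem v_injective (h22 : c.m₂₂ ≠ 0) {x y₁ y₂ : K} (hx : c.den x ≠ 0)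
    (h : c.v x y₁ = c.v x y₂) : y₁ = y₂ := by
  rw [v, v, div_left_inj' hx] at h
  have : c.m₂₂ * (y₁ - y₂) = 0 := by linear_combination h
  exact sub_eq_zero.1 ((mul_eq_zero.1 this).resolve_left h22)

/-- **`M` preserves collinearity** (it is linear): if `(x₁,y₁), (x₂,y₂), (x₃,y₃)` are collinear then
so are their transports. [cite: ArtebaniDolgachev2009, §3 (projectivities preserve lines)] -/
theorem collinear_transport {x₁ y₁ x₂ y₂ x₃ y₃ : K} (h₁ : c.den x₁ ≠ 0) (h₂ : c.den x₂ ≠ 0)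
    (h₃ : c.den x₃ ≠ 0) (hcol : (y₂ - y₁) * (x₃ - x₁) = (y₃ - y₁) * (x₂ - x₁)) :
    (c.v x₂ y₂ - c.v x₁ y₁) * (c.u x₃ - c.u x₁) = (c.v x₃ y₃ - c.v x₁ y₁) * (c.u x₂ - c.u x₁) := by
  have key :
      ((c.m₂₁ * x₂ + c.m₂₂ * y₂ + c.m₂₃) * c.den x₁ - c.den x₂ * (c.m₂₁ * x₁ + c.m₂₂ * y₁ + c.m₂₃)) *
        ((c.m₁₁ * x₃ + c.m₁₃) * c.den x₁ - c.den x₃ * (c.m₁₁ * x₁ + c.m₁₃)) =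
      ((c.m₂₁ * x₃ + c.m₂₂ * y₃ + c.m₂₃) * c.den x₁ - c.den x₃ * (c.m₂₁ * x₁ + c.m₂₂ * y₁ + c.m₂₃)) *
        ((c.m₁₁ * x₂ + c.m₁₃) * c.den x₁ - c.den x₂ * (c.m₁₁ * x₁ + c.m₁₃)) := by
    simp only [den]
    linear_combination
      c.m₂₂ * (c.m₁₁ * c.m₃₃ - c.m₁₃ * c.m₃₁) * (c.m₃₁ * x₁ + c.m₃₃) * hcol
  simp only [u, v]
  rw [div_sub_div _ _ h₂ h₁, div_sub_div _ _ h₃ h₁, div_sub_div _ _ h₃ h₁, div_sub_div _ _ h₂ h₁,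
    div_mul_div_comm, div_mul_div_comm, key, mul_comm (c.den x₂ * c.den x₁)]

end Datum


/-! ## §2. Points of order three and the transport of affine points -/

section Transport

variable {K : Type u} [Field K]

/-- **The affine points of order `3` are the zeros of `Ψ₃`** (Silverman–Tate Thm. 2.1 (c); the
tree's `addOrderOf_eq_three_iff_Ψ₃_eval_eq_zero`, restated for `3 • P = 0` with `3 : ℤ`).
[cite: SilvermanTate2015, §2.1, Thm. 2.1 (c)] -/
theorem three_zsmul_some_eq_zero_iff (E : WeierstrassCurve K) {x y : K}
    (h : E.toAffine.Nonsingular x y) :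
    (3 : ℤ) • (Affine.Point.some x y h) = 0 ↔ E.Ψ₃.eval x = 0 := by
  rw [show (3 : ℤ) = ((3 : ℕ) : ℤ) by norm_num, natCast_zsmul,
    ← addOrderOf_eq_three_iff_Ψ₃_eval_eq_zero E h]
  haveI : Fact (Nat.Prime 3) := ⟨Nat.prime_three⟩
  rw [addOrderOf_eq_prime_iff]
  exact ⟨fun h3 => ⟨h3, Affine.Point.some_ne_zero h⟩, fun h3 => h3.1⟩

/-- An element of order `3` of an additive group is not of order dividing `2`. [cite: SilvermanTate2015, §2.1, p. 39 ("Instead of 3P = O, we write 2P = −P")] -/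
theorem ne_neg_of_three_zsmul {A : Type*} [AddCommGroup A] {P : A} (h3 : (3 : ℤ) • P = 0)
    (hP : P ≠ 0) : P ≠ -P := by
  intro h
  apply hP
  have h2 : (2 : ℤ) • P = 0 := by
    rw [two_zsmul]
    nth_rw 2 [h]
    exact add_neg_cancel P
  have : P = (3 : ℤ) • P - (2 : ℤ) • P := by abel
  rw [this, h3, h2, sub_zero]

/-- For an element of order dividing `3`, `P + P = -P`. [cite: SilvermanTate2015, §2.1, p. 39 ("Instead of 3P = O, we write 2P = −P")] -/
theorem add_self_eq_neg_of_three_zsmul {A : Type*} [AddCommGroup A] {P : A}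
    (h3 : (3 : ℤ) • P = 0) : P + P = -P := by
  have h : P + P + P = (3 : ℤ) • P := by abel
  rw [h3] at h
  exact eq_neg_of_add_eq_zero_left h

variable (E E' : WeierstrassCurve K) (c : Datum K)

/-- **The transport of affine points** along the datum `c`: `O ↦ O`, and an affine point
`(x, y)` of `E'` goes to `(u, v) = (c.u x, c.v x y)` when that is a (nonsingular) point of `E`
(and to `O` otherwise — a junk value never used: on `E'[3]` the certificate guarantees the first
case). [cite: Fisher2012Hessian, §13, Thm. 13.2 (n = 3)] [cite: ArtebaniDolgachev2009, §2 (base points = flexes of each member)] -/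
def transport : E'.toAffine.Point → E.toAffine.Point
  | .zero => 0
  | .some x y _ => if h : E.toAffine.Nonsingular (c.u x) (c.v x y) then .some _ _ h else 0

/-- The transport sends `O` to `O`. [cite: Fisher2012Hessian, §13, Thm. 13.2 (n = 3)] -/
@[simp] theorem transport_zero : transport E E' c 0 = 0 := rfl

/-- The transport of an affine point whose image is a point of `E`. [cite: Fisher2012Hessian, §13, Thm. 13.2 (n = 3)] -/
theorem transport_some {x y : K} (h : E'.toAffine.Nonsingular x y)
    (h' : E.toAffine.Nonsingular (c.u x) (c.v x y)) :
    transport E E' c (.some x y h) = .some _ _ h' := by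
  show (if h : E.toAffine.Nonsingular (c.u x) (c.v x y) then Affine.Point.some _ _ h else 0) = _
  rw [dif_pos h']

variable {E E' c}

/-- The certificate: every affine flex `(x, y)` of `E'` (`Ψ₃^{E'}(x) = 0`) is carried to an affine
flex of `E`. This is the hypothesis under which everything below is proved.
[cite: Fisher2012Hessian, §13, Thm. 13.2 (n = 3)] [cite: ArtebaniDolgachev2009, §2 (base points = flexes of each member)] -/
structure IsFlexTransport (E E' : WeierstrassCurve K) (c : Datum K) : Prop where
  m₂₂_ne_zero : c.m₂₂ ≠ 0
  det_ne_zero : c.m₁₁ * c.m₃₃ - c.m₁₃ * c.m₃₁ ≠ 0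
  cert : ∀ x y : K, E'.toAffine.Equation x y → E'.Ψ₃.eval x = 0 →
    c.den x ≠ 0 ∧ E.toAffine.Equation (c.u x) (c.v x y) ∧ E.Ψ₃.eval (c.u x) = 0

namespace IsFlexTransport

variable (hc : IsFlexTransport E E' c)
include hc

/-- On an affine point of order `3`, the denominator does not vanish. [cite: ArtebaniDolgachev2009, §2 (base points = flexes of each member)] -/
theorem den_ne_zero {x y : K} (h : E'.toAffine.Nonsingular x y)
    (h3 : (3 : ℤ) • (Affine.Point.some x y h) = 0) : c.den x ≠ 0 :=
  (hc.cert x y h.1 ((three_zsmul_some_eq_zero_iff E' h).1 h3)).1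

variable [E.IsElliptic]

/-- On an affine point of order `3`, the transported pair is a nonsingular point of `E`. [cite: ArtebaniDolgachev2009, §2 (base points = flexes of each member)] -/
theorem nonsingular {x y : K} (h : E'.toAffine.Nonsingular x y)
    (h3 : (3 : ℤ) • (Affine.Point.some x y h) = 0) : E.toAffine.Nonsingular (c.u x) (c.v x y) :=
  (Affine.equation_iff_nonsingular (W := E.toAffine)).1
    (hc.cert x y h.1 ((three_zsmul_some_eq_zero_iff E' h).1 h3)).2.1

/-- On an affine point of order `3`, the transport is the affine point `(u, v)`. [cite: ArtebaniDolgachev2009, §2 (base points = flexes of each member)] -/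
theorem transport_eq {x y : K} (h : E'.toAffine.Nonsingular x y)
    (h3 : (3 : ℤ) • (Affine.Point.some x y h) = 0) :
    transport E E' c (.some x y h) = .some _ _ (hc.nonsingular h h3) :=
  transport_some E E' c h _

/-- The transport of a point of order `3` has order `3` (the flexes go to flexes). [cite: ArtebaniDolgachev2009, §2 (base points = flexes of each member)]
[cite: SilvermanTate2015, §2.1, Thm. 2.1 (c)] -/
theorem three_zsmul_transport {x y : K} (h : E'.toAffine.Nonsingular x y)
    (h3 : (3 : ℤ) • (Affine.Point.some x y h) = 0) :
    (3 : ℤ) • transport E E' c (.some x y h) = 0 := by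
  rw [hc.transport_eq h h3, three_zsmul_some_eq_zero_iff]
  exact (hc.cert x y h.1 ((three_zsmul_some_eq_zero_iff E' h).1 h3)).2.2

/-- The transport maps `E'[3]` into `E[3]`. [cite: ArtebaniDolgachev2009, §2 (base points = flexes of each member)] -/
theorem three_zsmul_transport_eq_zero {P : E'.toAffine.Point} (h3 : (3 : ℤ) • P = 0) :
    (3 : ℤ) • transport E E' c P = 0 := by
  rcases P with _ | ⟨x, y, h⟩
  · rw [← Affine.Point.zero_def, transport_zero, smul_zero]
  · exact hc.three_zsmul_transport h h3

/-- **Oddness**: on `E'[3]` the transport commutes with negation (the vertical line through `P`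
and `O` goes to the vertical line through the transport of `P` and `O`: negation is the third point on the
vertical line). [cite: SilvermanAEC2009, III.2, Group Law Algorithm 2.3] -/
theorem transport_neg {P : E'.toAffine.Point} (h3 : (3 : ℤ) • P = 0) :
    transport E E' c (-P) = -transport E E' c P := by
  rcases P with _ | ⟨x, y, h⟩
  · rw [← Affine.Point.zero_def, neg_zero, transport_zero, neg_zero]
  · have h3' : (3 : ℤ) • (-Affine.Point.some x y h) = 0 := by rw [zsmul_neg, h3, neg_zero]
    rw [Affine.Point.neg_some] at h3' ⊢
    rw [hc.transport_eq h h3, hc.transport_eq _ h3', Affine.Point.neg_some]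
    have hE₁ := (hc.nonsingular h h3).1
    have hE₂ := (hc.nonsingular _ h3').1
    rcases Affine.Y_eq_of_X_eq hE₂ hE₁ rfl with hy | hy
    · -- `v(x, ȳ) = v(x, y)` forces `ȳ = y`, i.e. `P = -P`: impossible for a point of order 3
      exfalso
      have hyy : E'.toAffine.negY x y = y := c.v_injective hc.m₂₂_ne_zero (hc.den_ne_zero h h3) hy
      apply ne_neg_of_three_zsmul h3 (Affine.Point.some_ne_zero h)
      rw [Affine.Point.neg_some]
      simp only [hyy]
    · simp only [hy]

/-- **Injectivity** of the transport on `E'[3]` (a Möbius map in `x`, affine in `y`). [cite: Fisher2012Hessian, §13, Thm. 13.2 (n = 3)] -/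
theorem transport_injective {P Q : E'.toAffine.Point} (hP : (3 : ℤ) • P = 0) (hQ : (3 : ℤ) • Q = 0)
    (h : transport E E' c P = transport E E' c Q) : P = Q := by
  rcases P with _ | ⟨x₁, y₁, h₁⟩ <;> rcases Q with _ | ⟨x₂, y₂, h₂⟩
  · rfl
  · rw [← Affine.Point.zero_def, transport_zero, hc.transport_eq h₂ hQ] at h
    exact absurd h.symm (Affine.Point.some_ne_zero _)
  · rw [← Affine.Point.zero_def, transport_zero, hc.transport_eq h₁ hP] at h
    exact absurd h (Affine.Point.some_ne_zero _)
  · rw [hc.transport_eq h₁ hP, hc.transport_eq h₂ hQ, Affine.Point.some.injEq] at h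
    have hx : x₁ = x₂ :=
      c.u_injective hc.det_ne_zero (hc.den_ne_zero h₁ hP) (hc.den_ne_zero h₂ hQ) h.1
    subst hx
    have hy : y₁ = y₂ := c.v_injective hc.m₂₂_ne_zero (hc.den_ne_zero h₁ hP) h.2
    subst hy
    rfl


/-- **Additivity on `E'[3]`** — the heart of the matter: for `P, Q ∈ E'[3]` with distinct
abscissae, `P`, `Q` and `R = -(P + Q)` are the three (collinear) intersections of the chord with
`E'`; their transports are collinear (the transport is projective-linear) affine flexes of `E`, hence
by the secant theorem on `E` (tree `eval_weierstrass_secant_eq_zero_iff`: a chord meets the cubic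
exactly in `U₁, U₂, -(U₁ + U₂)`) the transport of `R` is `-(U₁ + U₂)`. The cases `Q = ± P` follow
from oddness and `2P = -P`. ("three flexes are collinear iff they sum to `O`":
[cite: ArtebaniDolgachev2009, §2 (the group law on a plane cubic with an inflection point as origin;
Lemma 2.3)]; [cite: SilvermanAEC2009, III.2, Group Law Algorithm 2.3].) -/
theorem transport_add {P Q : E'.toAffine.Point} (hP : (3 : ℤ) • P = 0) (hQ : (3 : ℤ) • Q = 0) :
    transport E E' c (P + Q) = transport E E' c P + transport E E' c Q := by
  rcases P with _ | ⟨x₁, y₁, h₁⟩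
  · rw [← Affine.Point.zero_def, transport_zero, zero_add, zero_add]
  rcases Q with _ | ⟨x₂, y₂, h₂⟩
  · rw [← Affine.Point.zero_def, transport_zero, add_zero, add_zero]
  by_cases hx : x₁ = x₂
  · subst hx
    by_cases hy : y₁ = E'.toAffine.negY x₁ y₂
    · -- `Q = -P`
      have hQP : Affine.Point.some x₁ y₂ h₂ = -Affine.Point.some x₁ y₁ h₁ := by
        rw [Affine.Point.neg_some, Affine.Point.some.injEq]
        exact ⟨rfl, by rw [hy, Affine.negY_negY]⟩
      rw [Affine.Point.add_of_Y_eq rfl hy, transport_zero, hQP, hc.transport_neg hP, add_neg_cancel]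
    · -- `Q = P`
      have hy' : y₁ = y₂ := Affine.Y_eq_of_Y_ne h₁.1 h₂.1 rfl hy
      subst hy'
      rw [add_self_eq_neg_of_three_zsmul hP, hc.transport_neg hP,
        add_self_eq_neg_of_three_zsmul (hc.three_zsmul_transport_eq_zero hP)]
  · -- the chord case
    set ℓ := E'.toAffine.slope x₁ x₂ y₁ y₂ with hℓ
    set x₃ := E'.toAffine.addX x₁ x₂ ℓ with hx₃
    set y₃ := E'.toAffine.negAddY x₁ x₂ y₁ ℓ with hy₃
    have h₃ : E'.toAffine.Nonsingular x₃ y₃ := Affine.nonsingular_negAdd h₁ h₂ fun hxy => hx hxy.1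
    have hPQ : Affine.Point.some x₁ y₁ h₁ + Affine.Point.some x₂ y₂ h₂ = -Affine.Point.some x₃ y₃ h₃ :=
      Affine.Point.add_of_X_ne' hx
    have hR : (3 : ℤ) • Affine.Point.some x₃ y₃ h₃ = 0 := by
      have : Affine.Point.some x₃ y₃ h₃ =
          -(Affine.Point.some x₁ y₁ h₁ + Affine.Point.some x₂ y₂ h₂) := by rw [hPQ, neg_neg]
      rw [this, zsmul_neg, zsmul_add, hP, hQ, add_zero, neg_zero]
    rw [hPQ, hc.transport_neg hR, hc.transport_eq h₁ hP, hc.transport_eq h₂ hQ, hc.transport_eq h₃ hR]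
    -- data on `E`
    have hZ₁ := hc.den_ne_zero h₁ hP
    have hZ₂ := hc.den_ne_zero h₂ hQ
    have hZ₃ := hc.den_ne_zero h₃ hR
    have hE₁ := (hc.nonsingular h₁ hP).1
    have hE₂ := (hc.nonsingular h₂ hQ).1
    have hE₃ := (hc.nonsingular h₃ hR).1
    set u₁ := c.u x₁ with hu₁
    set u₂ := c.u x₂ with hu₂
    set u₃ := c.u x₃ with hu₃
    set v₁ := c.v x₁ y₁ with hv₁
    set v₂ := c.v x₂ y₂ with hv₂
    set v₃ := c.v x₃ y₃ with hv₃
    have hu : u₁ ≠ u₂ := fun h => hx (c.u_injective hc.det_ne_zero hZ₁ hZ₂ h)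
    rw [Affine.Point.add_of_X_ne' hu, neg_inj]
    set μ := E.toAffine.slope u₁ u₂ v₁ v₂ with hμ
    -- collinearity of `P, Q, R` and of their transports
    have hℓx : ℓ * (x₁ - x₂) = y₁ - y₂ := by
      rw [hℓ, Affine.slope_of_X_ne hx, div_mul_cancel₀ _ (sub_ne_zero.2 hx)]
    have hy₃' : y₃ - y₁ = ℓ * (x₃ - x₁) := by rw [hy₃, Affine.negAddY]; ring
    have hcol : (y₂ - y₁) * (x₃ - x₁) = (y₃ - y₁) * (x₂ - x₁) := by
      rw [hy₃']; linear_combination (x₃ - x₁) * hℓx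
    have hcolE : (v₂ - v₁) * (u₃ - u₁) = (v₃ - v₁) * (u₂ - u₁) :=
      c.collinear_transport hZ₁ hZ₂ hZ₃ hcol
    have hμ' : μ = (v₁ - v₂) / (u₁ - u₂) := by rw [hμ, Affine.slope_of_X_ne hu]
    have hv₃' : v₃ - v₁ = (u₃ - u₁) * μ := by
      rw [hμ', mul_div_assoc', eq_div_iff (sub_ne_zero.2 hu)]
      linear_combination hcolE
    -- the transport of `R` lies on the chord through `U₁, U₂` …
    have hvec : ![u₁, v₁, 1] + (u₃ - u₁) • ![1, μ, 0] = ![u₃, v₃, 1] := by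
      ext i
      fin_cases i
      · simp
      · simp only [Fin.mk_one, Pi.add_apply, Matrix.cons_val_one, Matrix.cons_val_zero,
          Pi.smul_apply, smul_eq_mul]
        linear_combination -hv₃'
      · simp
    have hon : MvPolynomial.eval (![u₁, v₁, 1] + (u₃ - u₁) • ![1, μ, 0])
        E.toProjective.polynomial = 0 := by
      rw [hvec]
      exact (WeierstrassCurve.Projective.equation_some u₃ v₃).2 hE₃
    -- … so by the secant theorem it is `U₁`, `U₂` or `-(U₁ + U₂)`
    rcases (eval_weierstrass_secant_eq_zero_iff E hE₁ hE₂ hu (u₃ - u₁)).1 hon with ht | ht | ht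
    · -- `u₃ = u₁`: then `R = ± P`, impossible
      exfalso
      have hx₃₁ : x₃ = x₁ := c.u_injective hc.det_ne_zero hZ₃ hZ₁ (by linear_combination ht)
      rcases (Affine.Point.X_eq_iff (h₁ := h₃) (h₂ := h₁)).1 hx₃₁ with hRP | hRP
      · -- `R = P`: `P + Q = -P = P + P`, so `Q = P`
        have h' : Affine.Point.some x₁ y₁ h₁ + Affine.Point.some x₂ y₂ h₂ =
            Affine.Point.some x₁ y₁ h₁ + Affine.Point.some x₁ y₁ h₁ := by
          rw [hPQ, hRP, add_self_eq_neg_of_three_zsmul hP]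
        have hQP := add_left_cancel h'
        rw [Affine.Point.some.injEq] at hQP
        exact hx hQP.1.symm
      · -- `R = -P`: `P + Q = P`, so `Q = O`
        have h' : Affine.Point.some x₁ y₁ h₁ + Affine.Point.some x₂ y₂ h₂ =
            Affine.Point.some x₁ y₁ h₁ := by rw [hPQ, hRP, neg_neg]
        exact Affine.Point.some_ne_zero h₂ (add_eq_left.mp h')
    · -- `u₃ = u₂`: then `R = ± Q`, impossible
      exfalso
      have hx₃₂ : x₃ = x₂ := c.u_injective hc.det_ne_zero hZ₃ hZ₂ (by linear_combination ht)
      rcases (Affine.Point.X_eq_iff (h₁ := h₃) (h₂ := h₂)).1 hx₃₂ with hRQ | hRQ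
      · have h' : Affine.Point.some x₁ y₁ h₁ + Affine.Point.some x₂ y₂ h₂ =
            Affine.Point.some x₂ y₂ h₂ + Affine.Point.some x₂ y₂ h₂ := by
          rw [hPQ, hRQ, add_self_eq_neg_of_three_zsmul hQ]
        have hQP := add_right_cancel h'
        rw [Affine.Point.some.injEq] at hQP
        exact hx hQP.1
      · have h' : Affine.Point.some x₁ y₁ h₁ + Affine.Point.some x₂ y₂ h₂ =
            Affine.Point.some x₂ y₂ h₂ := by rw [hPQ, hRQ, neg_neg]
        exact Affine.Point.some_ne_zero h₁ (add_eq_right.mp h')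
    · -- the third intersection: `U₃ = (addX, negAddY) = -(U₁ + U₂)`
      have hu₃' : u₃ = E.toAffine.addX u₁ u₂ μ := by linear_combination ht
      have hv₃'' : v₃ = E.toAffine.negAddY u₁ u₂ v₁ μ := by
        rw [Affine.negAddY, ← hu₃']; linear_combination hv₃'
      rw [Affine.Point.some.injEq]
      exact ⟨hu₃', hv₃''⟩

end IsFlexTransport

end Transport

end Literature.NumberTheory.EllipticCurves.FlexTransport
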